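import Summits.ResolutionOfSingularities.KangarooAtlas.MizutaniOdaOperators
import Summits.ResolutionOfSingularities.KangarooAtlas.MizutaniExponentCriterion
import Summits.ResolutionOfSingularities.KangarooAtlas.MizutaniGenericPoint
import Summits.ResolutionOfSingularities.KangarooAtlas.MizutaniLevelRadical
import Literature.RingTheory.MvPolynomial.LinearFormIdealsHeight
import HarnessLib

/-!
# Which subspaces `N_e ⊂ k^{n+1}` are the invariant forms of a Hironaka scheme: `𝒥_e𝒟_e(N_e) = N_e` (Mizutani Thm. 1.3)

Cell `pub-rosobs`, Mizutani enclosure (seat mizutani-encloser-1, gen 9).  AI-written; *AI review is weaker than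
expert review*; NOT a resolution-of-singularities theorem (summit relevance C).

Mizutani 1973 Thm. 1.3 (= Oda 1973 [O1] Thm. 2.5) with (*) of §1: the H-schemes of exponent `e` correspond to the pairs
`(V, W)`, `V ⊂ k ⊗_{k^q} W = L_e = k^{n+1}` (`q = p^e`), with (i) `𝒥_e𝒟_e(V) = V`, (ii) `V ⊊ k ⊗ W`,
(iii) `V ⊄ k·(V ∩ (k^p ⊗_{k^q} W))` if `e ≥ 1`; «moreover `γ(𝒟_e(N_e)·S)` is the most generic point».  With `dSpan = 𝒟_e`,
`jCore = 𝒥_e` (`MizutaniOdaOperators.lean`) this file proves all of it for the points of `ℙ^n_k`: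

* `qLinPoint k p e N = {f : f^{(F^e)} ∈ (Σ g_i X_i : g ∈ N)}`, the `q`-LINEAR POINT of `N ⊆ k^{n+1}` (the shape of `frobGen`,
  `genPoint`); `pointForms_qLinPoint` (`V_e = N`), **`invForms_qLinPoint : (L_B)_e = 𝒥_e(N)`**, `exponentLE_qLinPoint`,
  `isPoint_qLinPoint_iff` (`↔ N ≠ ⊤`), **`radical_span_addForm : rad((Σ g_i X_i^q : g ∈ N)·S) = qLinPoint N`** (Mizutani's `γ`);
* **`exists_isPoint_invForms_eq_iff`** — THM 1.3 / (*) (i)(ii): `V ⊆ k^{n+1}` is `(L_B)_e(𝔭)` of a point `𝔭` with exponent `≤ e`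
  **iff** `V ≠ ⊤` and `𝒥_e𝒟_e(V) = V`; the point is `qLinPoint e (𝒟_e V)`, contained in every prime `𝔶` with `V ⊆ (L_B)_e(𝔶)`
  (`qLinPoint_dSpan_le`); the same subspaces occur without the exponent clause (`exists_isPoint_invForms_eq_iff'`);
* **`genPoint_eq_qLinPoint_dSpan`**, **`genForms_eq_dSpan_invForms`** — for every point and every `e` the tree's most generic
  point `genPoint k p 𝔭 e` (`MizutaniGenericPoint`) IS Mizutani's `rad(𝒟_e(N_e)·S)`, and `genForms = 𝒟_e((L_B)_e)`;
  `mizutani_thm13_mostGeneric` — the «moreover» clause verbatim on Hironaka's objects `U(𝔭) ∩ L`, `U_+(𝔭)S`;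
* condition (iii) (exponent EXACTLY `e`) is `MizutaniHSchemeExponent.lean`.

References: H. Mizutani, Nagoya Math. J. 52 (1973), Thm. 1.3, (*) (i)–(iii), Rem. 1.4, §1 (d) [Mizutani1973HironakaGroupSchemes];
T. Oda, Publ. RIMS 19 (1983), Lemma 2.1, Thm. 2.2, Cor. 2.3 [Oda1983HironakaGroupSchemeII].
-/

noncomputable section

open MvPolynomial Literature.AlgebraicGeometry.Resolution Literature.AlgebraicGeometry.Resolution.HironakaScheme
  Literature.RingTheory.MvPolynomial Literature.RingTheory.HilbertSamuel

namespace Summit.ResolutionOfSingularities.KangarooAtlas.Mizutani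

universe u

/-! ## The `q`-linear point of a subspace -/

section QLinPoint

variable (k : Type u) [Field k] (p : ℕ) [hp : Fact p.Prime] [CharP k p] {n : ℕ} (e : ℕ)

/-- **The `q`-linear point of `N ⊆ k^{n+1}`** (`q = p^e`): `{f : f^{(F^e)} ∈ (Σ g_i X_i : g ∈ N)}`, the generic point of the
preimage of the linear space `V(Σ g_i X_i : g ∈ N)` under the `k`-linear Frobenius `x ↦ x^q`; `= rad((Σ g_i X_i^q : g ∈ N)·S)`
(`radical_span_addForm`). [cite: Mizutani1973HironakaGroupSchemes, Thm. 1.3 (γ(𝒟_e(N_e)S))] -/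
def qLinPoint (N : Submodule k (Fin (n + 1) → k)) : Ideal (MvPolynomial (Fin (n + 1)) k) :=
  (Ideal.span (linForm '' (N : Set (Fin (n + 1) → k)))).comap (MvPolynomial.map (iterateFrobenius k p e))

/-- `genPoint k p 𝔭 e` is the `q`-linear point of `W_e(𝔭) = genForms`. [folklore] -/
theorem genPoint_eq_qLinPoint (𝔭 : Ideal (MvPolynomial (Fin (n + 1)) k)) :
    genPoint k p 𝔭 e = qLinPoint k p e (genForms k p 𝔭 e) := rfl

variable (N : Submodule k (Fin (n + 1) → k))

omit hp [CharP k p] in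
/-- **A linear form lies in the ideal generated by the linear forms of `N` iff its coefficient vector lies in `N`.** [folklore] -/
theorem linForm_mem_span_linForm_iff {g : Fin (n + 1) → k} :
    linForm g ∈ Ideal.span (linForm '' (N : Set (Fin (n + 1) → k))) ↔ g ∈ N := by
  constructor
  · intro h
    have hT : N.map linForm ≤ homogeneousSubmodule (Fin (n + 1)) k 1 := by
      rw [← range_linForm]; exact LinearMap.map_le_range
    have hset : (linForm '' (N : Set (Fin (n + 1) → k))) = (N.map linForm : Set (MvPolynomial (Fin (n + 1)) k)) :=
      (Submodule.map_coe _ _).symm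
    rw [hset] at h
    have hmem := LinearFormIdealsHeight.mem_of_isHomogeneous_one_of_mem_span hT (isHomogeneous_linForm g) h
    obtain ⟨g', hg', hgg'⟩ := Submodule.mem_map.mp hmem
    rwa [← linForm_injective hgg']
  · intro h
    exact Ideal.subset_span ⟨g, h, rfl⟩

/-- `qLinPoint` is prime. [folklore] -/
theorem isPrime_qLinPoint : (qLinPoint k p e N).IsPrime := by
  haveI := isPrime_span_linForm N
  unfold qLinPoint
  exact Ideal.comap_isPrime _ _

/-- Membership in `qLinPoint`. [folklore] -/
theorem mem_qLinPoint_iff {f : MvPolynomial (Fin (n + 1)) k} :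
    f ∈ qLinPoint k p e N ↔
      MvPolynomial.map (iterateFrobenius k p e) f ∈ Ideal.span (linForm '' (N : Set (Fin (n + 1) → k))) :=
  Ideal.mem_comap

/-- **`Σ g_i X_i^q ∈ qLinPoint N ↔ g ∈ N`** (`(Σ g_i X_i^q)^{(F^e)} = (Σ g_i X_i)^q` and the linear ideal is prime). [folklore] -/
theorem addForm_mem_qLinPoint_iff {g : Fin (n + 1) → k} : addForm k p e g ∈ qLinPoint k p e N ↔ g ∈ N := by
  haveI := isPrime_span_linForm N
  rw [mem_qLinPoint_iff, map_iterateFrobenius_addForm]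
  have hpow : addForm k p e (frobVec k p e g) = linForm g ^ p ^ e := by
    rw [linForm_eq_addForm_zero k p, addForm_pow_pow, Nat.zero_add]
  rw [hpow]
  constructor
  · intro h
    exact (linForm_mem_span_linForm_iff k N).mp (Ideal.IsPrime.mem_of_pow_mem inferInstance _ h)
  · intro h
    exact Ideal.pow_mem_of_mem _ ((linForm_mem_span_linForm_iff k N).mpr h) _
      (Nat.pos_of_ne_zero (pow_ne_zero _ hp.out.ne_zero))

/-- **`V_e(qLinPoint N) = N`**: the additive forms of level `e` in the `q`-linear point of `N` are exactly those of `N`.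
[cite: Oda1983HironakaGroupSchemeII, Lemma 2.1 (3) (p. 1169)] -/
theorem pointForms_qLinPoint : pointForms k p (qLinPoint k p e N) e = N := by
  ext g
  rw [mem_pointForms_iff, addForm_mem_qLinPoint_iff]

/-- **`(L_B)_e(qLinPoint N) = 𝒥_e(N)`.** [cite: Oda1983HironakaGroupSchemeII, Cor. 2.3 (V = 𝒥'(U))] -/
theorem invForms_qLinPoint : invForms k p (qLinPoint k p e N) e = jCore k p e N := by
  rw [invForms_eq_jCore_pointForms, pointForms_qLinPoint]

/-- `exponent B(qLinPoint N) ≤ e` (`exponentLE_comap_span_linForm`). [cite: Oda1983HironakaGroupSchemeII, Cor. 2.3 (p. 1171)] -/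
theorem exponentLE_qLinPoint : ExponentLE k p (qLinPoint k p e N) e :=
  exponentLE_comap_span_linForm k p N e

/-- `X_i ∈ qLinPoint N ↔ e_i ∈ N`. [folklore] -/
theorem X_mem_qLinPoint_iff (i : Fin (n + 1)) :
    (X i : MvPolynomial (Fin (n + 1)) k) ∈ qLinPoint k p e N ↔ Pi.single i (1 : k) ∈ N := by
  rw [mem_qLinPoint_iff, map_X, ← linForm_single, linForm_mem_span_linForm_iff]

/-- `S_+ ⊆ qLinPoint N ↔ N = ⊤`. [folklore] -/
theorem irrelevant_le_qLinPoint_iff : irrelevant k n ≤ qLinPoint k p e N ↔ N = ⊤ := by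
  constructor
  · intro h
    rw [eq_top_iff]
    intro v _
    rw [pi_eq_sum_univ' v]
    refine N.sum_mem fun i _ => N.smul_mem _ ?_
    exact (X_mem_qLinPoint_iff k p e N i).mp (h (by simp [irrelevant]))
  · rintro rfl
    refine irrelevant_le_of_X_mem k fun i => ?_
    exact (X_mem_qLinPoint_iff k p e ⊤ i).mpr Submodule.mem_top

/-- Homogeneous components commute with a change of coefficients (local copy). [folklore] -/
private theorem homogeneousComponent_map_copy {R S : Type*} [CommRing R] [CommRing S] (f : R →+* S) (a : ℕ)
    (G : MvPolynomial (Fin (n + 1)) R) :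
    homogeneousComponent a (MvPolynomial.map f G) = MvPolynomial.map f (homogeneousComponent a G) := by
  classical
  refine MvPolynomial.ext _ _ fun m => ?_
  rw [coeff_homogeneousComponent, coeff_map, coeff_map, coeff_homogeneousComponent]
  split_ifs <;> simp

omit hp [CharP k p] in
/-- The linear ideal of `N` is homogeneous. [folklore] -/
theorem isHomogeneousIdeal_span_linForm : IsHomogeneousIdeal (Ideal.span (linForm '' (N : Set (Fin (n + 1) → k)))) := by
  refine isHomogeneousIdeal_span_of_isHomogeneous ?_
  rintro _ ⟨g, -, rfl⟩
  exact ⟨1, isHomogeneous_linForm g⟩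

/-- **`qLinPoint N` is a point of `ℙ^n_k` iff `N ≠ ⊤`** (it is always a homogeneous prime). [cite: Mizutani1973HironakaGroupSchemes, (*) (ii) and Remark 1.4] -/
theorem isPoint_qLinPoint_iff : IsPoint k (qLinPoint k p e N) ↔ N ≠ ⊤ := by
  constructor
  · intro h hN
    exact h.2.2 ((irrelevant_le_qLinPoint_iff k p e N).mpr hN)
  · intro hN
    refine ⟨isPrime_qLinPoint k p e N, fun f hf d => ?_, fun hle => hN ((irrelevant_le_qLinPoint_iff k p e N).mp hle)⟩
    rw [mem_qLinPoint_iff] at hf ⊢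
    rw [← homogeneousComponent_map_copy]
    exact isHomogeneousIdeal_span_linForm k N _ hf d

/-- `f ∈ qLinPoint N ⇒ f^q ∈ (Σ g_i X_i^q : g ∈ N)·S` (`f^q = f^{(F^e)}(X^q)`). [cite: Mizutani1973HironakaGroupSchemes, Thm. 1.3 (γ(…·S))] -/
theorem pow_mem_span_addForm_of_mem_qLinPoint {f : MvPolynomial (Fin (n + 1)) k} (hf : f ∈ qLinPoint k p e N) :
    f ^ p ^ e ∈ Ideal.span (addForm k p e '' (N : Set (Fin (n + 1) → k))) := by
  rw [mem_qLinPoint_iff] at hf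
  have hmap : (Ideal.span (linForm '' (N : Set (Fin (n + 1) → k)))).map
      ((expand (p ^ e) : MvPolynomial (Fin (n + 1)) k →ₐ[k] MvPolynomial (Fin (n + 1)) k) :
        MvPolynomial (Fin (n + 1)) k →+* MvPolynomial (Fin (n + 1)) k) =
      Ideal.span (addForm k p e '' (N : Set (Fin (n + 1) → k))) := by
    rw [Ideal.map_span, ← Set.image_comp]
    congr 1
    refine Set.image_congr' fun g => ?_
    rw [Function.comp_apply, RingHom.coe_coe, expand_linForm_eq_addForm]
  have h := Ideal.mem_map_of_mem
    ((expand (p ^ e) : MvPolynomial (Fin (n + 1)) k →ₐ[k] MvPolynomial (Fin (n + 1)) k) :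
      MvPolynomial (Fin (n + 1)) k →+* MvPolynomial (Fin (n + 1)) k) hf
  rw [hmap, RingHom.coe_coe, expand_map_iterateFrobenius] at h
  exact h

/-- **Mizutani's `γ(N·S)`: the radical of the ideal `(Σ g_i X_i^q : g ∈ N)·S` of `q`-th power forms IS the `q`-linear point
of `N`.** [cite: Mizutani1973HironakaGroupSchemes, Thm. 1.3 ("γ(𝒟_e(N_e)S) is the most generic point")] -/
theorem radical_span_addForm :
    (Ideal.span (addForm k p e '' (N : Set (Fin (n + 1) → k)))).radical = qLinPoint k p e N := by
  haveI := isPrime_qLinPoint k p e N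
  refine le_antisymm ?_ fun f hf => ⟨p ^ e, pow_mem_span_addForm_of_mem_qLinPoint k p e N hf⟩
  rw [Ideal.IsPrime.radical_le_iff inferInstance, Ideal.span_le]
  rintro _ ⟨g, hg, rfl⟩
  exact (addForm_mem_qLinPoint_iff k p e N).mpr hg

/-- **The `q`-linear point of `𝒟_e(V)` lies in every prime `𝔶` whose level-`e` invariant forms contain `V`**
(`𝒟_e(V) ⊆ 𝒟_e((L_B)_e(𝔶)) ⊆ V_e(𝔶)`, so the `q`-th power forms of `𝒟_e(V)` lie in `𝔶`). [cite: Mizutani1973HironakaGroupSchemes, §1 (d) and Thm. 1.3] -/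
theorem qLinPoint_dSpan_le {V : Submodule k (Fin (n + 1) → k)} {𝔶 : Ideal (MvPolynomial (Fin (n + 1)) k)} [𝔶.IsPrime]
    (h : V ≤ invForms k p 𝔶 e) : qLinPoint k p e (dSpan k p e V) ≤ 𝔶 := by
  intro f hf
  have hpow := pow_mem_span_addForm_of_mem_qLinPoint k p e _ hf
  have hle : Ideal.span (addForm k p e '' (dSpan k p e V : Set (Fin (n + 1) → k))) ≤ 𝔶 := by
    rw [Ideal.span_le]
    rintro _ ⟨w, hw, rfl⟩
    have hw' : w ∈ pointForms k p 𝔶 e := dSpan_invForms_le_pointForms k p 𝔶 e (dSpan_mono k p e h hw)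
    exact (mem_pointForms_iff k p 𝔶 e).mp hw'
  exact Ideal.IsPrime.mem_of_pow_mem inferInstance _ (hle hpow)

end QLinPoint

/-! ## Theorem 1.3: which subspaces occur -/

section Criterion

variable (k : Type u) [Field k] (p : ℕ) [hp : Fact p.Prime] [CharP k p] {n : ℕ} (e : ℕ)

omit hp [CharP k p] in
/-- `Σ_j δ_{ij} X_j^{q} = X_i^q`. [folklore] -/
theorem addForm_single (i : Fin (n + 1)) : addForm k p e (Pi.single i (1 : k)) = X i ^ p ^ e := by
  unfold addForm
  rw [Finset.sum_eq_single i]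
  · rw [Pi.single_eq_same, C_1, one_mul]
  · intro j _ hji
    rw [Pi.single_eq_of_ne hji, C_0, zero_mul]
  · intro h; exact absurd (Finset.mem_univ i) h

omit hp [CharP k p] in
/-- The additive forms of level `e` in a POINT form a proper subspace (`X_i^q ∉ 𝔭` for some `i`). [folklore] -/
theorem pointForms_ne_top (𝔭 : Ideal (MvPolynomial (Fin (n + 1)) k)) (hP : IsPoint k 𝔭) : pointForms k p 𝔭 e ≠ ⊤ := by
  haveI := hP.1
  intro h
  refine hP.2.2 (irrelevant_le_of_X_mem k fun i => ?_)
  have hi : Pi.single i (1 : k) ∈ pointForms k p 𝔭 e := by rw [h]; exact Submodule.mem_top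
  rw [mem_pointForms_iff, addForm_single] at hi
  exact Ideal.IsPrime.mem_of_pow_mem inferInstance _ hi

/-- The invariant forms of level `e` of a point form a proper subspace (Mizutani's (ii) `V ⊊ k ⊗ W`).
[cite: Mizutani1973HironakaGroupSchemes, (*) (ii)] -/
theorem invForms_ne_top (𝔭 : Ideal (MvPolynomial (Fin (n + 1)) k)) (hP : IsPoint k 𝔭) : invForms k p 𝔭 e ≠ ⊤ := by
  intro h
  apply pointForms_ne_top k p e 𝔭 hP
  have hle : invForms k p 𝔭 e ≤ pointForms k p 𝔭 e := by
    rw [invForms_eq_jCore_pointForms]; exact jCore_le k p e _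
  exact eq_top_iff.mpr (h ▸ hle)

/-- The realising point: if `𝒥_e𝒟_e(V) = V` then `(L_B)_e(qLinPoint e (𝒟_e V)) = V`. [cite: Mizutani1973HironakaGroupSchemes, Thm. 1.3] -/
theorem invForms_qLinPoint_dSpan {V : Submodule k (Fin (n + 1) → k)} (hV : jCore k p e (dSpan k p e V) = V) :
    invForms k p (qLinPoint k p e (dSpan k p e V)) e = V := by
  rw [invForms_qLinPoint, hV]

/-- **MIZUTANI'S THEOREM 1.3 / (*) (i)(ii) — WHICH SUBSPACES OCCUR.**  `V ⊆ k^{n+1} = L_e` is the space `(L_B)_e(𝔭)` of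
level-`e` invariant additive forms of some point `𝔭` of `ℙ^n_k` with `exponent B(𝔭) ≤ e` iff `V ≠ ⊤` and `𝒥_e(𝒟_e(V)) = V`
(necessity `𝒥𝒟𝒥 = 𝒥`; sufficiency: the `q`-linear point of `𝒟_e(V)`).  AI-written; *AI review is weaker than expert review*.
[cite: Mizutani1973HironakaGroupSchemes, Thm. 1.3 and (*) (i), (ii)] -/
theorem exists_isPoint_invForms_eq_iff (V : Submodule k (Fin (n + 1) → k)) :
    (∃ 𝔭 : Ideal (MvPolynomial (Fin (n + 1)) k), IsPoint k 𝔭 ∧ ExponentLE k p 𝔭 e ∧ invForms k p 𝔭 e = V) ↔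
      (V ≠ ⊤ ∧ jCore k p e (dSpan k p e V) = V) := by
  constructor
  · rintro ⟨𝔭, hP, -, rfl⟩
    exact ⟨invForms_ne_top k p e 𝔭 hP, jCore_dSpan_invForms k p 𝔭 e⟩
  · rintro ⟨hne, hV⟩
    refine ⟨qLinPoint k p e (dSpan k p e V), ?_, exponentLE_qLinPoint k p e _, invForms_qLinPoint_dSpan k p e hV⟩
    exact (isPoint_qLinPoint_iff k p e _).mpr (dSpan_ne_top_of_jCore_dSpan_eq k p e hV hne)

/-- The same subspaces occur WITHOUT the exponent clause (the level-`e` invariant forms of any point are those of its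
`q`-linear generization, which has exponent `≤ e`). [cite: Mizutani1973HironakaGroupSchemes, Thm. 1.3] -/
theorem exists_isPoint_invForms_eq_iff' (V : Submodule k (Fin (n + 1) → k)) :
    (∃ 𝔭 : Ideal (MvPolynomial (Fin (n + 1)) k), IsPoint k 𝔭 ∧ invForms k p 𝔭 e = V) ↔
      (V ≠ ⊤ ∧ jCore k p e (dSpan k p e V) = V) := by
  constructor
  · rintro ⟨𝔭, hP, rfl⟩
    exact ⟨invForms_ne_top k p e 𝔭 hP, jCore_dSpan_invForms k p 𝔭 e⟩
  · intro h
    obtain ⟨𝔭, hP, -, hV⟩ := (exists_isPoint_invForms_eq_iff k p e V).mpr h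
    exact ⟨𝔭, hP, hV⟩

/-- The realising point `𝔤 = qLinPoint e (𝒟_e V)` of a closed proper `V`: a point, exponent `≤ e`, `(L_B)_e(𝔤) = V`, and
`𝔤 ⊆ 𝔶` for every prime `𝔶` with `V ⊆ (L_B)_e(𝔶)`. [cite: Mizutani1973HironakaGroupSchemes, Thm. 1.3 and §1 (d)] -/
theorem qLinPoint_dSpan_realises {V : Submodule k (Fin (n + 1) → k)} (hne : V ≠ ⊤) (hV : jCore k p e (dSpan k p e V) = V) :
    IsPoint k (qLinPoint k p e (dSpan k p e V)) ∧ ExponentLE k p (qLinPoint k p e (dSpan k p e V)) e ∧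
      invForms k p (qLinPoint k p e (dSpan k p e V)) e = V ∧
      ∀ (𝔶 : Ideal (MvPolynomial (Fin (n + 1)) k)) [𝔶.IsPrime], V ≤ invForms k p 𝔶 e → qLinPoint k p e (dSpan k p e V) ≤ 𝔶 :=
  ⟨(isPoint_qLinPoint_iff k p e _).mpr (dSpan_ne_top_of_jCore_dSpan_eq k p e hV hne), exponentLE_qLinPoint k p e _,
    invForms_qLinPoint_dSpan k p e hV, fun _ _ h => qLinPoint_dSpan_le k p e h⟩

end Criterion

/-! ## The most generic point is `rad(𝒟_e(N_e)·S)`; `genForms = 𝒟_e((L_B)_e)` -/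

section MostGeneric

variable (k : Type u) [Field k] (p : ℕ) [hp : Fact p.Prime] [CharP k p] {n : ℕ}
  (𝔭 : Ideal (MvPolynomial (Fin (n + 1)) k)) (e : ℕ)

/-- **`genPoint k p 𝔭 e = qLinPoint e (𝒟_e((L_B)_e(𝔭)))` for every point `𝔭` and every `e`** — the tree's most generic point
(built from `Σ_{j ≤ e} F^{e−j} 𝒟_j((L_B)_j(𝔭))`) is Mizutani's `γ(𝒟_e(N_e)·S)`.  (`⊇`: `qLinPoint_dSpan_le`; `⊆`: `genPoint_le`,
the lower levels of the `q`-linear point being recovered from level `e` by the level radical `mem_invForms_iff_frobVec_mem`.)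
[cite: Mizutani1973HironakaGroupSchemes, Thm. 1.3 ("γ(𝒟_e(N_e)S) is the most generic point")] -/
theorem genPoint_eq_qLinPoint_dSpan [𝔭.IsPrime] (hP : IsPoint k 𝔭) :
    genPoint k p 𝔭 e = qLinPoint k p e (dSpan k p e (invForms k p 𝔭 e)) := by
  haveI := isPrime_genPoint k p 𝔭 e
  haveI := isPrime_qLinPoint k p e (dSpan k p e (invForms k p 𝔭 e))
  have hM : IsPoint k (qLinPoint k p e (dSpan k p e (invForms k p 𝔭 e))) := by
    refine (isPoint_qLinPoint_iff k p e _).mpr fun h => pointForms_ne_top k p e 𝔭 hP ?_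
    exact eq_top_iff.mpr (h ▸ dSpan_invForms_le_pointForms k p 𝔭 e)
  refine le_antisymm (genPoint_le k p 𝔭 e fun j hj a ha => ?_)
    (qLinPoint_dSpan_le k p e (invForms_le_invForms_genPoint k p 𝔭 e le_rfl))
  -- `a ∈ (L_B)_j(𝔭)`, `j ≤ e`: `F^{e−j} a ∈ (L_B)_e(𝔭) ⊆ 𝒥_e𝒟_e((L_B)_e(𝔭)) = (L_B)_e(𝔪)`, then the level radical for `𝔪`
  obtain ⟨m, rfl⟩ := Nat.exists_eq_add_of_le hj
  rw [mem_invForms_iff_frobVec_mem k p _ hM j m, invForms_qLinPoint]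
  exact le_jCore_dSpan k p (j + m) _ ((mem_invForms_iff_frobVec_mem k p 𝔭 hP j m a).mp ha)

/-- **`W_e(𝔭) = 𝒟_e((L_B)_e(𝔭))`** (`genForms = dSpan ∘ invForms`) for every point and every level: the contributions
`F^{e−j}𝒟_j((L_B)_j)` of the lower levels already lie in `𝒟_e((L_B)_e)`. [cite: Mizutani1973HironakaGroupSchemes, Thm. 1.3] -/
theorem genForms_eq_dSpan_invForms [𝔭.IsPrime] (hP : IsPoint k 𝔭) :
    genForms k p 𝔭 e = dSpan k p e (invForms k p 𝔭 e) := by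
  have h := congrArg (fun I : Ideal (MvPolynomial (Fin (n + 1)) k) => pointForms k p I e)
    (genPoint_eq_qLinPoint_dSpan k p 𝔭 e hP)
  simp only [genPoint_eq_qLinPoint, pointForms_qLinPoint] at h
  exact h

/-- **`rad(𝒟_e((L_B)_e(𝔭))·S) = genPoint k p 𝔭 e`** — Mizutani's formula for the most generic point, literally.
[cite: Mizutani1973HironakaGroupSchemes, Thm. 1.3 ("γ(𝒟_e(N_e)S)")] -/
theorem radical_span_addForm_dSpan_invForms [𝔭.IsPrime] (hP : IsPoint k 𝔭) :
    (Ideal.span (addForm k p e '' (dSpan k p e (invForms k p 𝔭 e) : Set (Fin (n + 1) → k)))).radical =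
      genPoint k p 𝔭 e := by
  rw [radical_span_addForm, genPoint_eq_qLinPoint_dSpan k p 𝔭 e hP]

/-- **THM 1.3, «MOREOVER» CLAUSE, VERBATIM**: for every point `𝔭` of `ℙ^n_k` with `N_e = (U(𝔭) ∩ L)_e`, `e = exponent B(𝔭)`,
the radical `𝔤` of the ideal `𝒟_e(N_e)·S` (generated by the `q`-th power forms `Σ w_i X_i^q`, `w ∈ 𝒟_e(N_e)`) is a point with
`B_{P,𝔤} = B_{P,𝔭}` (`U_+(𝔤)S = U_+(𝔭)S`) contained in every point `𝔶` with `B_{P,𝔶} = B_{P,𝔭}` — the most generic point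
associated with the H-scheme (§1 (d)).  AI-written; *AI review is weaker than expert review*; not a resolution theorem.
[cite: Mizutani1973HironakaGroupSchemes, Thm. 1.3 and §1 (d)] -/
theorem mizutani_thm13_mostGeneric [𝔭.IsPrime] (hP : IsPoint k 𝔭) :
    let 𝔤 := (Ideal.span (addForm k p (exponent k p 𝔭) ''
      (dSpan k p (exponent k p 𝔭) (hirForms k p 𝔭 (exponent k p 𝔭)) : Set (Fin (n + 1) → k)))).radical
    ∃ _ : 𝔤.IsPrime, IsPoint k 𝔤 ∧ bIdeal k 𝔤 = bIdeal k 𝔭 ∧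
      ∀ (𝔶 : Ideal (MvPolynomial (Fin (n + 1)) k)) [𝔶.IsPrime], IsPoint k 𝔶 → bIdeal k 𝔶 = bIdeal k 𝔭 → 𝔤 ≤ 𝔶 := by
  intro 𝔤
  have h𝔤 : 𝔤 = genPoint k p 𝔭 (exponent k p 𝔭) := by
    show (Ideal.span _).radical = _
    rw [hirForms_eq_invForms, radical_span_addForm_dSpan_invForms k p 𝔭 _ hP]
  obtain ⟨hG, hB, hle⟩ := genPoint_isMostGeneric k p 𝔭 hP
  haveI := isPrime_genPoint k p 𝔭 (exponent k p 𝔭)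
  rw [h𝔤]
  exact ⟨inferInstance, hG, hB, fun 𝔶 _ hY h => hle 𝔶 hY h⟩

end MostGeneric

end Summit.ResolutionOfSingularities.KangarooAtlas.Mizutani

end
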